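/-
COR-CM (cell pub-hodgecm2, stage 2 of the Hodge ladder) — count-neutral kernel combinatorics (seat prover-pub-hodgecm2-b23-g53-0, binder
prover b23, gen 53; lane SYLOW TRANSFER XIV «the order-8p assembly», blanket `Census/SylowTransfer*` HOME/INBOX.md l.23357, claim l.24246).
Theorems only, in seat b09's intrinsic model (consumed BY NAME, nothing restated); no definition, no certificate, no `decide`, no named fact, no
geometry, no `sorry`.  `Interfaces.lean` (C1), every E term, B01 and `Transposition/*` are untouched.
HONEST FRAMING: `HC_CM` is NOT proved, here or anywhere in the tree; nothing here is a period or a headline.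
-/
import Summits.HodgeConjecture.CorCM.Census.SylowTransferShearedElements

/-!
# Sylow transfer, XIV: every group of order `8p`, `p ≥ 5` prime — the Sylow `p`-subgroup is normal

Part XIII settled every group of order `8pᵏ` (`p` an odd prime) with a NORMAL cyclic subgroup of order `pᵏ`.  Here the normality is discharged by
Sylow counting whenever `p ≥ 5` and `G` has a central involution `c`:
* §1 `zpowers_normal_of_card_eq_eight_mul_prime_pow`: `|G| = 8pᵏ`, `ord z = pᵏ`, `p ≥ 5` ⟹ `⟨z⟩ ⊴ G`.  Indeed `⟨z⟩` is a Sylow `p`-subgroup, the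
  number `n` of Sylow `p`-subgroups divides `8` and is `≡ 1 (mod p)`; `n = 8` would make the normaliser of order `pᵏ`, but it contains the central
  involution `c`; and `2, 4 ≢ 1 (mod p)` for `p ≥ 5` (for `p = 3`, `n = 4` does occur: `SL(2,3)`).
* §2 **THE LAWS**: **every group of order `8pᵏ` (`p ≥ 5` prime, `k ≥ 1`) with an element of order `pᵏ`, and EVERY GROUP OF ORDER `8p` (`p ≥ 5`
  prime) — every central involution `c ≠ 1`: `μ(G, c) = φ₂(G, c)`** (`isLeast_card_gfaces_generate_fibreTwo_of_card_eq_eight_mul_prime_of_five_le`),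
  NO element hypothesis, NO datum; rows `|G| = 40, 56, 88`.  With gen 51ʼs parts III/VII/IX, gen 52ʼs XII and the sheared dihedral law: ORDER `8p`
  IS COMPLETE FOR EVERY `p ≥ 5`, and order `24` is complete except `SL(2,3)`.
* §3 normal-subgroup forms for every odd `p` (incl. `p = 3`): a normal cyclic subgroup of order `pᵏ` (`…_of_normal_cyclic_prime_pow`), a normal
  subgroup of order `p` (`…_of_normal_card_prime`) — the shape a field seat meets as «a Galois subfield of degree `8`».
All [folklore] bookkeeping over [Pohlmann1968, Thm 1] in the reading of [Milne1999, Prop. 2.1].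

## References
* [Pohlmann1968] H. Pohlmann, Algebraic cycles on abelian varieties of complex multiplication type, Ann. of Math. 88 (1968), Thm 1.
* [Milne1999] J. S. Milne, Lefschetz motives and the Tate conjecture, Compositio Math. 117 (1999), Prop. 2.1, p. 54.
-/

namespace Summit.HodgeConjecture.CorCM.Census.SylowTransfer

open Finset
open Summit.HodgeConjecture.CorCM.Prior.AllgGroup.RfwfAllgGroup
open Summit.HodgeConjecture.CorCM.Census.BlockParity
open Summit.HodgeConjecture.CorCM.Census.Coinvariant

noncomputable section

section Group

variable {G : Type*} [Group G]

/-! ## §1 Sylow counting: the cyclic subgroup of order `pᵏ` is normal for `p ≥ 5` -/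

/-- A central element normalises every subgroup. [folklore] -/
theorem mem_normalizer_of_central (H : Subgroup G) {c : G} (hcen : ∀ w : G, w * c = c * w) :
    c ∈ Subgroup.normalizer (H : Set G) := by
  rw [Subgroup.mem_normalizer_iff]
  intro h
  rw [← hcen h, mul_inv_cancel_right]

/-- `(8·pᵏ).factorization p = k` for an odd prime `p`. [folklore] -/
theorem factorization_eight_mul_prime_pow {p k : ℕ} (hp : p.Prime) (hp2 : p ≠ 2) : (8 * p ^ k).factorization p = k := by
  have h8 : ¬ p ∣ 8 := fun h => by
    have := (Nat.prime_dvd_prime_iff_eq hp Nat.prime_two).mp (hp.dvd_of_dvd_pow (show p ∣ 2 ^ 3 by simpa using h))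
    exact hp2 this
  rw [Nat.factorization_mul (by norm_num) (pow_ne_zero _ hp.ne_zero), Finsupp.add_apply, Nat.factorization_eq_zero_of_not_dvd h8,
    zero_add, Nat.factorization_pow, Finsupp.smul_apply, smul_eq_mul, hp.factorization_self, mul_one]

/-- **`|G| = 8pᵏ` (`p ≥ 5` PRIME) WITH A CENTRAL INVOLUTION, `ord z = pᵏ` ⟹ `⟨z⟩` IS NORMAL**: `⟨z⟩` is a Sylow `p`-subgroup; the number of Sylow
`p`-subgroups divides `8`, is `≡ 1 (mod p)`, and is not `8` (the normaliser contains the central involution, so its order is even). [folklore] -/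
theorem zpowers_normal_of_card_eq_eight_mul_prime_pow [Fintype G] {p k : ℕ} (hp : p.Prime) (hp5 : 5 ≤ p)
    (hG : Fintype.card G = 8 * p ^ k) {z : G} (hz : orderOf z = p ^ k) {c : G} (hc2 : c * c = 1) (hc1 : c ≠ 1)
    (hcen : ∀ w : G, w * c = c * w) : (Subgroup.zpowers z).Normal := by
  classical
  haveI : Fact p.Prime := ⟨hp⟩
  haveI : Fact (Nat.Prime 2) := ⟨Nat.prime_two⟩
  have hp2 : p ≠ 2 := by omega
  have hpk0 : p ^ k ≠ 0 := pow_ne_zero _ hp.ne_zero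
  have hfac : (Nat.card G).factorization p = k := by
    rw [Nat.card_eq_fintype_card (α := G), hG, factorization_eight_mul_prime_pow hp hp2]
  set Q : Sylow p G := Sylow.ofCard (Subgroup.zpowers z) (by rw [Nat.card_zpowers, hz, hfac]) with hQ
  have hQz : (Q : Subgroup G) = Subgroup.zpowers z := rfl
  -- `[G : ⟨z⟩] = 8`
  have hQidx : (Q : Subgroup G).index = 8 := by
    have h := (Q : Subgroup G).card_mul_index
    rw [hQz, Nat.card_zpowers, hz, Nat.card_eq_fintype_card (α := G), hG, mul_comm 8] at h
    rw [hQz]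
    exact Nat.eq_of_mul_eq_mul_left (Nat.pos_of_ne_zero hpk0) h
  -- the normaliser and the number of Sylow `p`-subgroups
  set N := Subgroup.normalizer ((Q : Subgroup G) : Set G) with hN
  have hn : Nat.card (Sylow p G) = N.index := Q.card_eq_index_normalizer
  have hdvd : N.index ∣ 8 := by rw [← hn, ← hQidx]; exact Q.card_dvd_index
  have hmod : N.index ≡ 1 [MOD p] := by rw [← hn]; exact card_sylow_modEq_one p G
  have hcN : c ∈ N := mem_normalizer_of_central _ hcen
  have hordc : orderOf c = 2 := orderOf_eq_prime (by rw [pow_two, hc2]) hc1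
  -- `N.index ≠ 8`
  have hne8 : N.index ≠ 8 := by
    intro h8
    have hcardN : Nat.card N = p ^ k := by
      have h := N.card_mul_index
      rw [h8, Nat.card_eq_fintype_card (α := G), hG, mul_comm 8] at h
      exact Nat.eq_of_mul_eq_mul_right (by norm_num) h
    have h2 : 2 ∣ p ^ k := by rw [← hordc, ← hcardN]; exact N.orderOf_dvd_natCard hcN
    have := (Nat.prime_dvd_prime_iff_eq Nat.prime_two hp).mp (Nat.prime_two.dvd_of_dvd_pow h2)
    omega
  -- `N.index ∈ {1, 2, 4}` and `≡ 1 (mod p)`, `p ≥ 5`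
  obtain ⟨i, hi, hNi⟩ := (Nat.dvd_prime_pow Nat.prime_two).mp (show N.index ∣ 2 ^ 3 by simpa using hdvd)
  have hN1 : N.index = 1 := by
    have hmod' : N.index % p = 1 % p := hmod
    rw [Nat.mod_eq_of_lt (show 1 < p by omega)] at hmod'
    interval_cases i
    · simpa using hNi
    · exfalso
      rw [hNi, pow_one, Nat.mod_eq_of_lt (show 2 < p by omega)] at hmod'
      omega
    · exfalso
      rw [hNi, show (2 : ℕ) ^ 2 = 4 by norm_num, Nat.mod_eq_of_lt (show 4 < p by omega)] at hmod'
      omega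
    · exfalso
      exact hne8 (by rw [hNi]; norm_num)
  have hNtop : N = ⊤ := Subgroup.index_eq_one.mp hN1
  have hnormal : (Q : Subgroup G).Normal := Subgroup.normalizer_eq_top_iff.mp hNtop
  rwa [hQz] at hnormal

end Group

variable {G : Type*} [Group G] [Fintype G] [DecidableEq G]

/-! ## §2 The laws for `p ≥ 5` -/

/-- **ORDER `8pᵏ` (`p ≥ 5` PRIME, `k ≥ 1`) WITH AN ELEMENT OF ORDER `pᵏ`, EVERY CENTRAL INVOLUTION: `μ(G, c) = φ₂(G, c)`** — no further
hypothesis (Sylow counting §1 + part XIII). [folklore] -/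
theorem isLeast_card_gfaces_generate_fibreTwo_of_card_eq_eight_mul_prime_pow_of_five_le (c : G) {p k : ℕ} (hp : p.Prime)
    (hp5 : 5 ≤ p) (hk : 1 ≤ k) (hG : Fintype.card G = 8 * p ^ k) (z : G) (hz : orderOf z = p ^ k)
    (hc2 : c * c = 1) (hc1 : c ≠ 1) (hcen : ∀ w : G, w * c = c * w) :
    IsLeast {m : ℕ | ∃ S : Finset (CMF G c →₀ ℤ), (↑S ⊆ gfaceSet G c hc2) ∧ S.card = m ∧
      hodgeSpan c hc2 ≤ Submodule.span ℤ (pairSet c) ⊔ Submodule.span ℤ (translates c S)} (fibreTwo c hc2) := by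
  have hnormal := zpowers_normal_of_card_eq_eight_mul_prime_pow hp hp5 hG hz hc2 hc1 hcen
  exact isLeast_card_gfaces_generate_fibreTwo_of_normal_zpowers_prime_pow c hp (by omega) hk hG z hz
    (fun w => hnormal.conj_mem z (Subgroup.mem_zpowers z) w) hc2 hc1 hcen

/-- **EVERY GROUP OF ORDER `8p` (`p ≥ 5` PRIME), EVERY CENTRAL INVOLUTION: `μ(G, c) = φ₂(G, c)`** — NO element hypothesis, NO datum
(Cauchy gives an element of order `p`).  Order `8p` is thereby COMPLETE for every `p ≥ 5`. [folklore] -/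
theorem isLeast_card_gfaces_generate_fibreTwo_of_card_eq_eight_mul_prime_of_five_le (c : G) {p : ℕ} (hp : p.Prime) (hp5 : 5 ≤ p)
    (hG : Fintype.card G = 8 * p) (hc2 : c * c = 1) (hc1 : c ≠ 1) (hcen : ∀ w : G, w * c = c * w) :
    IsLeast {m : ℕ | ∃ S : Finset (CMF G c →₀ ℤ), (↑S ⊆ gfaceSet G c hc2) ∧ S.card = m ∧
      hodgeSpan c hc2 ≤ Submodule.span ℤ (pairSet c) ⊔ Submodule.span ℤ (translates c S)} (fibreTwo c hc2) := by
  haveI : Fact p.Prime := ⟨hp⟩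
  obtain ⟨z, hz⟩ := exists_prime_orderOf_dvd_card p (show p ∣ Fintype.card G by rw [hG]; exact Dvd.intro_left 8 rfl)
  exact isLeast_card_gfaces_generate_fibreTwo_of_card_eq_eight_mul_prime_pow_of_five_le c hp hp5 le_rfl (by rw [pow_one, hG]) z
    (by rw [pow_one, hz]) hc2 hc1 hcen

/-- **Row `|G| = 40`**: every group of order `40`, every central involution: `μ = φ₂`. [folklore] -/
theorem isLeast_card_gfaces_generate_fibreTwo_of_card_eq_forty (c : G) (hG : Fintype.card G = 40)
    (hc2 : c * c = 1) (hc1 : c ≠ 1) (hcen : ∀ w : G, w * c = c * w) :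
    IsLeast {m : ℕ | ∃ S : Finset (CMF G c →₀ ℤ), (↑S ⊆ gfaceSet G c hc2) ∧ S.card = m ∧
      hodgeSpan c hc2 ≤ Submodule.span ℤ (pairSet c) ⊔ Submodule.span ℤ (translates c S)} (fibreTwo c hc2) :=
  isLeast_card_gfaces_generate_fibreTwo_of_card_eq_eight_mul_prime_of_five_le c (p := 5) (by norm_num) le_rfl (by rw [hG])
    hc2 hc1 hcen

/-- **Row `|G| = 56`**: every group of order `56`, every central involution: `μ = φ₂`. [folklore] -/
theorem isLeast_card_gfaces_generate_fibreTwo_of_card_eq_fiftySix (c : G) (hG : Fintype.card G = 56)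
    (hc2 : c * c = 1) (hc1 : c ≠ 1) (hcen : ∀ w : G, w * c = c * w) :
    IsLeast {m : ℕ | ∃ S : Finset (CMF G c →₀ ℤ), (↑S ⊆ gfaceSet G c hc2) ∧ S.card = m ∧
      hodgeSpan c hc2 ≤ Submodule.span ℤ (pairSet c) ⊔ Submodule.span ℤ (translates c S)} (fibreTwo c hc2) :=
  isLeast_card_gfaces_generate_fibreTwo_of_card_eq_eight_mul_prime_of_five_le c (p := 7) (by norm_num) (by norm_num) (by rw [hG])
    hc2 hc1 hcen

/-- **Row `|G| = 88`**: every group of order `88`, every central involution: `μ = φ₂`. [folklore] -/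
theorem isLeast_card_gfaces_generate_fibreTwo_of_card_eq_eightyEight (c : G) (hG : Fintype.card G = 88)
    (hc2 : c * c = 1) (hc1 : c ≠ 1) (hcen : ∀ w : G, w * c = c * w) :
    IsLeast {m : ℕ | ∃ S : Finset (CMF G c →₀ ℤ), (↑S ⊆ gfaceSet G c hc2) ∧ S.card = m ∧
      hodgeSpan c hc2 ≤ Submodule.span ℤ (pairSet c) ⊔ Submodule.span ℤ (translates c S)} (fibreTwo c hc2) :=
  isLeast_card_gfaces_generate_fibreTwo_of_card_eq_eight_mul_prime_of_five_le c (p := 11) (by norm_num) (by norm_num) (by rw [hG])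
    hc2 hc1 hcen

/-! ## §3 Normal-subgroup forms for every odd prime (incl. `p = 3`) -/

/-- **ORDER `8pᵏ` (`p` AN ODD PRIME, `k ≥ 1`) WITH A NORMAL CYCLIC SUBGROUP OF ORDER `pᵏ`, EVERY CENTRAL INVOLUTION: `μ(G, c) = φ₂(G, c)`.**
[folklore] -/
theorem isLeast_card_gfaces_generate_fibreTwo_of_normal_cyclic_prime_pow (c : G) {p k : ℕ} (hp : p.Prime) (hp2 : p ≠ 2)
    (hk : 1 ≤ k) (hG : Fintype.card G = 8 * p ^ k) (H : Subgroup G) [hH : H.Normal] (hHc : Nat.card H = p ^ k)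
    (hcyc : IsCyclic H) (hc2 : c * c = 1) (hc1 : c ≠ 1) (hcen : ∀ w : G, w * c = c * w) :
    IsLeast {m : ℕ | ∃ S : Finset (CMF G c →₀ ℤ), (↑S ⊆ gfaceSet G c hc2) ∧ S.card = m ∧
      hodgeSpan c hc2 ≤ Submodule.span ℤ (pairSet c) ⊔ Submodule.span ℤ (translates c S)} (fibreTwo c hc2) := by
  obtain ⟨g, hg⟩ := IsCyclic.exists_generator (α := H)
  have hordg : orderOf (g : G) = p ^ k := by
    rw [Subgroup.orderOf_coe, orderOf_eq_card_of_forall_mem_zpowers hg, hHc]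
  have hzp : Subgroup.zpowers (g : G) = H := by
    apply le_antisymm (Subgroup.zpowers_le.mpr g.2)
    intro x hx
    obtain ⟨m, hm⟩ := Subgroup.mem_zpowers_iff.mp (hg ⟨x, hx⟩)
    exact Subgroup.mem_zpowers_iff.mpr ⟨m, by rw [← Subgroup.coe_zpow, hm]⟩
  refine isLeast_card_gfaces_generate_fibreTwo_of_normal_zpowers_prime_pow c hp hp2 hk hG (g : G) hordg (fun w => ?_) hc2 hc1 hcen
  rw [hzp]
  exact hH.conj_mem _ g.2 w

/-- **ORDER `8p` (`p` AN ODD PRIME) WITH A NORMAL SUBGROUP OF ORDER `p`, EVERY CENTRAL INVOLUTION: `μ(G, c) = φ₂(G, c)`** (order `24`: every group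
with a normal subgroup of order `3`, i.e. everything but `SL(2,3)`). [folklore] -/
theorem isLeast_card_gfaces_generate_fibreTwo_of_normal_card_prime (c : G) {p : ℕ} (hp : p.Prime) (hp2 : p ≠ 2)
    (hG : Fintype.card G = 8 * p) (H : Subgroup G) [hH : H.Normal] (hHc : Nat.card H = p)
    (hc2 : c * c = 1) (hc1 : c ≠ 1) (hcen : ∀ w : G, w * c = c * w) :
    IsLeast {m : ℕ | ∃ S : Finset (CMF G c →₀ ℤ), (↑S ⊆ gfaceSet G c hc2) ∧ S.card = m ∧
      hodgeSpan c hc2 ≤ Submodule.span ℤ (pairSet c) ⊔ Submodule.span ℤ (translates c S)} (fibreTwo c hc2) := by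
  haveI : Fact p.Prime := ⟨hp⟩
  have hcyc : IsCyclic H := isCyclic_of_prime_card (p := p) hHc
  exact isLeast_card_gfaces_generate_fibreTwo_of_normal_cyclic_prime_pow c hp hp2 (k := 1) le_rfl (by rw [pow_one, hG]) H
    (by rw [pow_one, hHc]) hcyc hc2 hc1 hcen

end

end Summit.HodgeConjecture.CorCM.Census.SylowTransfer
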